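import Mathlib.RingTheory.MvPolynomial.Basic
import Mathlib.Algebra.CharP.Lemmas
import Mathlib.Algebra.MvPolynomial.CommRing
import Mathlib.RingTheory.Nilpotent.Defs
import Mathlib.FieldTheory.Perfect
import HarnessLib

/-!
# The reduced monomials `∏ Xᵢ^{aᵢ}` (`0 ≤ aᵢ < p`) are independent over `p`-th powers in `k[X_σ]`, characteristic `p`
# (crux `FInjectiveMacaulayfication` stmt-ResolutionOfSingularities-15315, chain w45a; LEMMA N♭ Tier-2 piece (B), polynomial half;
# res-L1-w45a-plan-1 R18.1 (3); seat res-L1-w45a-stub-1 g10)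

[OURS · L1 W4.5a] Support file (`--supports stmt-ResolutionOfSingularities-15315 --as helper`); replaces the role of NO printed item; NOT a
statement of any manuscript; def-free, unconditional; AI-written (AI review is weaker than expert review).

For a commutative ring `k` of exponential characteristic `p` and a finite index type `σ`, write every exponent `m = p • e + a` with
`a : σ → Fin p`. THIS FILE: the coefficient formula
`coeff (p • e + a) (Σ_b s_b ^ p · ∏ᵢ Xᵢ^{bᵢ}) = (coeff e s_a) ^ p` (`coeff_sum_pow_mul_prod`) — the `p^{|σ|}` "parity classes" of monomials do
not interact — hence over a reduced `k`: `Σ_b s_b ^ p · ∏ᵢ Xᵢ^{bᵢ} = 0 ⇒ s = 0` (`eq_zero_of_sum_pow_mul_prod_eq_zero`) and the representation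
`P = Σ_b s_b ^ p · X^b` is unique (`sum_pow_mul_prod_injective`): the reduced monomials are a basis of `k[X]` over `k^p[X^p]` as far as
independence goes (existence of the representation needs `k` perfect and is not used by the consumer). Used by `…MonomialPBasis` (the `K²`-basis of
the fraction field of the P2d4C specimen `k[x,y,u,t,z]/(z²+x⁴z+y³+u³+t³)`). [folklore: `p`-bases of polynomial rings]
-/

-- single-problem summit: the doubled namespace component is forced
set_option linter.dupNamespace false

namespace Summit.ResolutionOfSingularities.ResolutionOfSingularities.Theorems.FInjectiveMacaulayfication.MonomialPBasisParity

open MvPolynomial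

variable {σ : Type*} {k : Type*} [CommRing k] (p : ℕ) [ExpChar k p]

/-- In exponential characteristic `p`: `s ^ p = Σ_{d ∈ supp s} monomial (p • d) (coeff d s ^ p)` (Frobenius is additive). [folklore] -/
theorem pow_expChar_eq_sum_monomial (s : MvPolynomial σ k) :
    s ^ p = ∑ d ∈ s.support, monomial (p • d) (coeff d s ^ p) := by
  conv_lhs => rw [s.as_sum]
  rw [sum_pow_char p]
  exact Finset.sum_congr rfl fun d _ => by rw [monomial_pow]

variable [Fintype σ]

/-- The reduced monomial `∏ᵢ Xᵢ ^ eᵢ` is `monomial e 1`. [folklore] -/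
theorem prod_X_pow_eq_monomial (e : σ → ℕ) :
    (∏ i, X i ^ e i : MvPolynomial σ k) = monomial (Finsupp.equivFunOnFinite.symm e) 1 := by
  rw [MvPolynomial.monomial_eq, C_1, one_mul, Finsupp.prod_fintype _ _ (fun i => pow_zero _)]
  simp only [Finsupp.coe_equivFunOnFinite_symm]

/-- Exponent bookkeeping: `p • d + b = p • e + a` with `a b : σ → Fin p` iff `d = e` and `b = a` (compare modulo `p`, then divide by `p`). [folklore] -/
theorem smul_add_eq_smul_add_iff (hp : 0 < p) {d e : σ →₀ ℕ} {a b : σ → Fin p} :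
    p • d + Finsupp.equivFunOnFinite.symm (fun i => (b i : ℕ)) = p • e + Finsupp.equivFunOnFinite.symm (fun i => (a i : ℕ)) ↔
      d = e ∧ b = a := by
  constructor
  · intro h
    have hi : ∀ i, (b i : ℕ) + p * d i = (a i : ℕ) + p * e i := fun i => by
      have := DFunLike.congr_fun h i
      simp only [Finsupp.coe_add, Finsupp.coe_smul, Pi.add_apply, Pi.smul_apply, smul_eq_mul,
        Finsupp.coe_equivFunOnFinite_symm] at this
      linarith
    have hba : ∀ i, (b i : ℕ) = a i := fun i => by
      have h1 := congrArg (· % p) (hi i)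
      simp only [Nat.add_mul_mod_self_left, Nat.mod_eq_of_lt (b i).isLt, Nat.mod_eq_of_lt (a i).isLt] at h1
      exact h1
    refine ⟨Finsupp.ext fun i => ?_, funext fun i => Fin.ext (hba i)⟩
    have h2 := hi i
    rw [hba i, add_right_inj] at h2
    exact Nat.eq_of_mul_eq_mul_left hp h2
  · rintro ⟨rfl, rfl⟩
    rfl

variable [DecidableEq σ]

/-- **Coefficient of one parity summand**: `coeff (p • e + a) (s ^ p · ∏ᵢ Xᵢ^{bᵢ}) = [b = a] · (coeff e s) ^ p`. [folklore] -/
theorem coeff_pow_mul_prod (s : MvPolynomial σ k) (b a : σ → Fin p) (e : σ →₀ ℕ) :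
    coeff (p • e + Finsupp.equivFunOnFinite.symm (fun i => (a i : ℕ))) (s ^ p * ∏ i, X i ^ (b i : ℕ)) =
      if b = a then coeff e s ^ p else 0 := by
  rw [prod_X_pow_eq_monomial, pow_expChar_eq_sum_monomial p s, Finset.sum_mul]
  simp_rw [monomial_mul, mul_one, coeff_sum, coeff_monomial, smul_add_eq_smul_add_iff p (expChar_pos k p)]
  by_cases hba : b = a
  · simp only [hba, and_true, Finset.sum_ite_eq', if_true]
    split_ifs with he
    · rfl
    · rw [notMem_support_iff.mp he, zero_pow (expChar_pos k p).ne']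
  · simp [hba]

/-- ★ **The parity classes do not interact**: `coeff (p • e + a) (Σ_b s_b ^ p · ∏ᵢ Xᵢ^{bᵢ}) = (coeff e s_a) ^ p`. [folklore] -/
theorem coeff_sum_pow_mul_prod (s : (σ → Fin p) → MvPolynomial σ k) (a : σ → Fin p) (e : σ →₀ ℕ) :
    coeff (p • e + Finsupp.equivFunOnFinite.symm (fun i => (a i : ℕ))) (∑ b, s b ^ p * ∏ i, X i ^ (b i : ℕ)) = coeff e (s a) ^ p := by
  rw [coeff_sum]
  simp_rw [coeff_pow_mul_prod p]
  rw [Finset.sum_ite_eq', if_pos (Finset.mem_univ a)]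

/-- ★ **Independence of the reduced monomials over `p`-th powers** (reduced coefficient ring): `Σ_b s_b ^ p · ∏ᵢ Xᵢ^{bᵢ} = 0 ⇒ s_a = 0` for every `a`.
[folklore: `p`-bases of polynomial rings] -/
theorem eq_zero_of_sum_pow_mul_prod_eq_zero [IsReduced k] (s : (σ → Fin p) → MvPolynomial σ k)
    (h : ∑ b, s b ^ p * ∏ i, X i ^ (b i : ℕ) = 0) (a : σ → Fin p) : s a = 0 := by
  ext e
  have he := coeff_sum_pow_mul_prod p s a e
  rw [h, coeff_zero] at he
  rw [coeff_zero]
  exact IsReduced.eq_zero _ ⟨p, he.symm⟩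

/-- ★ **Uniqueness of the representation `P = Σ_b s_b ^ p · ∏ᵢ Xᵢ^{bᵢ}`** (reduced coefficient ring). [folklore] -/
theorem sum_pow_mul_prod_injective [IsReduced k] (s t : (σ → Fin p) → MvPolynomial σ k)
    (h : ∑ b, s b ^ p * ∏ i, X i ^ (b i : ℕ) = ∑ b, t b ^ p * ∏ i, X i ^ (b i : ℕ)) : s = t := by
  funext a
  have h0 : ∑ b, (s b - t b) ^ p * ∏ i, X i ^ (b i : ℕ) = 0 := by
    simp_rw [sub_pow_expChar, sub_mul, Finset.sum_sub_distrib, h, sub_self]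
  exact sub_eq_zero.mp (eq_zero_of_sum_pow_mul_prod_eq_zero p _ h0 a)

/-! ## Existence of the representation over a perfect coefficient ring -/

omit [DecidableEq σ] in
/-- One monomial: `monomial u c = (monomial ⌊u/p⌋ ρ) ^ p · ∏ᵢ Xᵢ^{uᵢ mod p}` with `ρ ^ p = c`. [folklore] -/
theorem monomial_eq_pow_mul_prod (u : σ →₀ ℕ) (c ρ : k) (hρ : ρ ^ p = c) :
    (monomial u c : MvPolynomial σ k) =
      monomial (Finsupp.equivFunOnFinite.symm fun i => u i / p) ρ ^ p *
        ∏ i, X i ^ ((fun i => (⟨u i % p, Nat.mod_lt _ (expChar_pos k p)⟩ : Fin p)) i : ℕ) := by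
  have hu : p • (Finsupp.equivFunOnFinite.symm fun i => u i / p) +
      Finsupp.equivFunOnFinite.symm (fun i => ((fun i => (⟨u i % p, Nat.mod_lt _ (expChar_pos k p)⟩ : Fin p)) i : ℕ)) = u := by
    ext i
    simp only [Finsupp.coe_add, Finsupp.coe_smul, Pi.add_apply, Pi.smul_apply, smul_eq_mul, Finsupp.coe_equivFunOnFinite_symm]
    exact Nat.div_add_mod (u i) p
  rw [prod_X_pow_eq_monomial, monomial_pow, monomial_mul, hρ, mul_one, hu]

/-- ★ **Existence** (perfect coefficient ring of exponential characteristic `p`): every `P ∈ k[X_σ]` is `Σ_b s_b ^ p · ∏ᵢ Xᵢ^{bᵢ}` for some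
family `s : (σ → Fin p) → k[X_σ]` — together with `sum_pow_mul_prod_injective`: the `p^{|σ|}` reduced monomials form a basis of `k[X]` over
`k[X]^p = k[X₁^p, …]`. [folklore: `p`-bases of polynomial rings] -/
theorem exists_eq_sum_pow_mul_prod [PerfectRing k p] (P : MvPolynomial σ k) :
    ∃ s : (σ → Fin p) → MvPolynomial σ k, P = ∑ b, s b ^ p * ∏ i, X i ^ (b i : ℕ) := by
  classical
  induction P using MvPolynomial.induction_on' with
  | monomial u c =>
    obtain ⟨ρ, hρ⟩ := surjective_frobenius k p c
    rw [frobenius_def] at hρ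
    refine ⟨fun b => if b = (fun i => (⟨u i % p, Nat.mod_lt _ (expChar_pos k p)⟩ : Fin p)) then
      monomial (Finsupp.equivFunOnFinite.symm fun i => u i / p) ρ else 0, ?_⟩
    rw [monomial_eq_pow_mul_prod p u c ρ hρ]
    symm
    rw [Finset.sum_eq_single (fun i => (⟨u i % p, Nat.mod_lt _ (expChar_pos k p)⟩ : Fin p))]
    · dsimp only
      rw [if_pos rfl]
    · intro b _ hb
      dsimp only
      rw [if_neg hb, zero_pow (expChar_pos k p).ne', zero_mul]
    · intro h
      exact absurd (Finset.mem_univ _) h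
  | add P Q hP hQ =>
    obtain ⟨s, hs⟩ := hP
    obtain ⟨t, ht⟩ := hQ
    refine ⟨s + t, ?_⟩
    rw [hs, ht, ← Finset.sum_add_distrib]
    exact Finset.sum_congr rfl fun b _ => by rw [Pi.add_apply, add_pow_expChar, add_mul]

end Summit.ResolutionOfSingularities.ResolutionOfSingularities.Theorems.FInjectiveMacaulayfication.MonomialPBasisParity
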